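import Literature.Topology.FourManifolds.PlanarAchiralWordsInvariants
import Literature.Topology.FourManifolds.PlanarLefschetzBody
import Literature.Topology.FourManifolds.PlanarLefschetzBodyFacts
import Literature.Topology.FourManifolds.SphereSimplyConnected
import Literature.Geometry.Symplectic.PlanarContactBoundary
import Literature.Geometry.Symplectic.PlanarMonodromy
import Literature.Geometry.Symplectic.PlanarSteinDictionary
import Summits.SmoothPoincare4.SmoothPoincare4.Theorems.ConvexBisectionPlanarAcyclicBisectionRigidityHelperReachMon
import Summits.SmoothPoincare4.SmoothPoincare4.Theorems.ConvexBisectionPlanarAcyclicBisectionRigidityHelperConnectedSeam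
import HarnessLib

/-!
# Crux `ConvexBisection.PlanarAcyclicBisectionRigidity`, line Sketch v3.0 — THE DICTIONARY, PROVED FROM THE NAMED FACTS

The four glue theorems of skeleton v3.0 (`Cruxes/PlanarAcyclicBisectionRigidity/Lines/Sketch.lean`,
§2), landed as registered helpers so that they are durable tree declarations:

* `helper_wordManifold_of_reachable` — the five moves of the planar word calculus re-read the same
  closed manifold along the whole orbit `Reachable` (induction on the equivalence closure, from
  the fact `planarWordManifold_move_iff`);
* `helper_dictionary_read` — THE READ: under the crux hypotheses (Stein bisection of a homotopy
  4-sphere along a common contact seam, ℚ-acyclic halves, a planar supporting open book of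
  `(∂W₁, ξ₁)`), there is a homotopy-sphere word `(n; A, B)` with `M = X̂(P_n; A B̄ʳᵉᵛ)`: the seam is
  connected (`helper_connected_seam`, p142877), F-a `supportedPlanarMonodromy` re-tubes the open
  book into a positively framed planar monodromy chart, Wendl (`wendl_planarSteinBisection`) reads
  both halves and the closed-up manifold, the readers give the lengths (ℚ-acyclicity), the normal
  generation (`π₁(M) = 1`) and the unimodularity of `A` (`H₁(W₁;ℤ) = 0`);
* `helper_dictionary_double` — WRITE-BACK (ii): a reachable block form with letterwise equal
  twists exhibits `M` as the double of a CONTRACTIBLE compact Stein domain whose boundary complex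
  tangencies are supported by a planar open book with `n′ + 1` binding components (moves; orbit
  invariants `holes_of_reachable` / `length_of_reachable`, p115709; the double fact;
  Loi–Piergallini + Gay; the doubled-body contractibility reader);
* `helper_dictionary_sc` — WRITE-BACK (iv): a reachable block form with two simply connected
  blocks re-bisects `M` along a common contact seam into two CONTRACTIBLE compact Stein domains
  (moves; `helper_reachable_monodromy_eq`, p130030; Baykur; the sc-body contractibility reader).

The facts are hypotheses (`(h : fact)`), so everything here is unconditional; the skeleton
instantiates them with its named-fact stub `stub_dictionaryFacts`.
-/

noncomputable section

open scoped Manifold ContDiff Topology ContinuousMap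
open Set Function
open Literature.Geometry.Symplectic Literature.AlgebraicTopology.SingularHomology CategoryTheory.Limits
open Literature.Topology.FourManifolds (BoundaryData IsDouble IsPlanarLefschetzBody IsPlanarWordManifold
  simplyConnectedSpace_euclideanSphere)
open Literature.Topology.FourManifolds.PlanarWords

-- the prescribed namespace `Summit.<S>.<P>.…` repeats `SmoothPoincare4` (S = P = SmoothPoincare4)
set_option linter.dupNamespace false

namespace Summit.SmoothPoincare4.SmoothPoincare4.Theorems.PlanarAcyclicBisectionRigidity.Sketch

/-- Local notation: the round 4-sphere with its Mathlib manifold structure. -/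
local notation "𝕊⁴" => (Metric.sphere (0 : EuclideanSpace ℝ (Fin 5)) 1)

/-- Local notation: the model space `ℝ⁴`. -/
local notation "E4" => EuclideanSpace ℝ (Fin 4)


/-- The curves of a positive word (bookkeeping). [folklore] -/
theorem map_fst_positiveWord (A : List PlanarCurve) : (positiveWord A).map Prod.fst = A := by
  induction A with
  | nil => rfl
  | cons c A ih => exact congrArg (List.cons c) ih

/-- The positive letters of a block form are the letters of its first block. [folklore] -/
theorem mem_blockForm_left {A B : List PlanarCurve} {c : PlanarCurve} (hc : c ∈ A) :
    (c, true) ∈ blockForm A B :=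
  List.mem_append.2 (Or.inl (List.mem_map.2 ⟨c, hc, rfl⟩))

/-- The negative letters of a block form are the letters of its second block. [folklore] -/
theorem mem_blockForm_right {A B : List PlanarCurve} {c : PlanarCurve} (hc : c ∈ B) :
    (c, false) ∈ blockForm A B :=
  List.mem_append.2 (Or.inr (List.mem_reverse.2 (List.mem_map.2 ⟨c, hc, rfl⟩)))

/-- Along the orbit of an integral homotopy-sphere word, every curve of every reachable block form
encloses a nonempty in-page block (`holes_of_reachable`, p115709, read on the two blocks).
[folklore] -/
theorem holes_of_reachable_blockForm {n n' : ℕ} {A B A' B' : List PlanarCurve}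
    (hw : IsIntegralSphereWord n A B) (hr : Reachable (n, blockForm A B) (n', blockForm A' B')) :
    ∀ c ∈ A' ++ B', c.a ≤ c.b ∧ c.b < n' := by
  intro c hc
  rcases List.mem_append.1 hc with hA | hB
  · exact holes_of_reachable hw hr (c, true) (mem_blockForm_left hA)
  · exact holes_of_reachable hw hr (c, false) (mem_blockForm_right hB)

/-- **The moves re-read the same closed manifold, along the whole orbit**: `Reachable` is the
equivalence closure of `Move`, and each move is an `iff` for `IsPlanarWordManifold` by the fact
`planarWordManifold_move_iff`. [folklore] -/
theorem helper_wordManifold_of_reachable (hM : planarWordManifold_move_iff)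
    (M : Type) [TopologicalSpace M] [T2Space M] [SecondCountableTopology M] [ChartedSpace E4 M]
    [IsManifold (𝓡 4) ∞ M] {s t : ℕ × List Letter} (hr : Reachable s t)
    (hs : IsPlanarWordManifold M s.1 s.2) : IsPlanarWordManifold M t.1 t.2 := by
  induction hr with
  | refl => exact hs
  | tail _ hst ih =>
    rcases hst with h | h
    · exact (hM M _ _ h).1 ih
    · exact (hM M _ _ h).2 ih

/-- **A homotopy 4-sphere is simply connected** (`S⁴` is, PROVED in tree; transport along `≃ₕ`).
[folklore] -/
theorem simplyConnected_of_homotopyEquiv_sphere (M : Type) [TopologicalSpace M] (hM : M ≃ₕ 𝕊⁴) :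
    SimplyConnectedSpace M :=
  haveI : SimplyConnectedSpace 𝕊⁴ := simplyConnectedSpace_euclideanSphere (n := 4) (by norm_num)
  hM.simplyConnectedSpace

/-- **THE READ.**  Under the crux hypotheses, unbundled, with the planar supporting open book `ob`
of `(∂W₁, ξ₁)` explicit: there is a (rational) HOMOTOPY-SPHERE WORD `(n; A, B)` — in-range curves,
`n` letters a side, equal monodromies, curves jointly normally generating `F_n` — together with the
READER `H₁(W₁; ℤ) = 0 → Unimodular n A`, such that `M` IS the planar word manifold of the block form
`A · B̄ʳᵉᵛ`.  Proof: the seam is connected (`helper_connected_seam`); F-a re-tubes `ob` into a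
positively framed `K′` with planar monodromy `(n, φ)` in Giroux form `α` for `ξ₁`; Wendl (F-WB) reads
both halves and the closed-up manifold; the `χ`-reader gives the lengths from ℚ-acyclicity, the
`π₁`-reader gives `NormallyGenerates` from `M ≃ₕ S⁴`, the `H₁`-reader gives the unimodularity of `A`.
[folklore] -/
theorem helper_dictionary_read (hFa : supportedPlanarMonodromy) (hW : wendl_planarSteinBisection)
    (hRlen : planarLefschetzBody_length_of_acyclic) (hRuni : planarLefschetzBody_unimodular_of_isZero_H1)
    (hRng : planarWordManifold_normallyGenerates_of_simplyConnected)
    (M : Type) [TopologicalSpace M] [T2Space M] [SecondCountableTopology M] [ChartedSpace E4 M]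
    [IsManifold (𝓡 4) ∞ M] (hM : M ≃ₕ 𝕊⁴)
    (W₁ : Type) [TopologicalSpace W₁] [ChartedSpace (EuclideanHalfSpace 4) W₁] [IsManifold (𝓡∂ 4) ∞ W₁]
    [CompactSpace W₁] (W₂ : Type) [TopologicalSpace W₂] [ChartedSpace (EuclideanHalfSpace 4) W₂]
    [IsManifold (𝓡∂ 4) ∞ W₂] [CompactSpace W₂] (J₁ : SteinStructure W₁) (J₂ : SteinStructure W₂)
    (e₁ : W₁ → M) (e₂ : W₂ → M)
    (he₁ : Manifold.IsSmoothEmbedding (𝓡∂ 4) (𝓡 4) ∞ e₁)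
    (he₂ : Manifold.IsSmoothEmbedding (𝓡∂ 4) (𝓡 4) ∞ e₂)
    (hcover : range e₁ ∪ range e₂ = univ)
    (hseam₁ : range e₁ ∩ range e₂ = e₁ '' (𝓡∂ 4).boundary W₁)
    (hseam₂ : range e₁ ∩ range e₂ = e₂ '' (𝓡∂ 4).boundary W₂)
    (hξ : ∀ w₁ w₂, e₁ w₁ = e₂ w₂ →
      Submodule.map (mfderiv (𝓡∂ 4) (𝓡 4) e₁ w₁).toLinearMap (contactPlane J₁.J w₁) =
      Submodule.map (mfderiv (𝓡∂ 4) (𝓡 4) e₂ w₂).toLinearMap (contactPlane J₂.J w₂))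
    (hac : ∀ k, 0 < k → IsZero (singularHomology ℚ ℚ W₁ k) ∧ IsZero (singularHomology ℚ ℚ W₂ k))
    (b₁ : BoundaryData (𝓡∂ 4) W₁ (𝓡 3)) (ob : OpenBook b₁.carrier) (hpl : ob.IsPlanar)
    (hsupp : ob.Supports (boundaryPlaneField J₁.J b₁)) :
    ∃ (n : ℕ) (A B : List PlanarCurve),
      (∀ c ∈ A ++ B, c.InRange n) ∧ A.length = n ∧ B.length = n ∧
      monodromy n (positiveWord A) = monodromy n (positiveWord B) ∧ NormallyGenerates n (A ++ B) ∧
      (IsZero (singularHomology ℤ ℤ W₁ 1) → Unimodular n A) ∧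
      IsPlanarWordManifold M n (blockForm A B) := by
  -- point-set preliminaries: the halves are Hausdorff and second countable (embedded in `M`)
  haveI : T2Space W₁ := he₁.isEmbedding.t2Space
  haveI : T2Space W₂ := he₂.isEmbedding.t2Space
  haveI : SecondCountableTopology W₁ := he₁.isEmbedding.secondCountableTopology
  haveI : SecondCountableTopology W₂ := he₂.isEmbedding.secondCountableTopology
  -- the seam model is a connected closed 3-manifold
  haveI : T2Space b₁.carrier := b₁.isSmoothEmbedding.isEmbedding.t2Space
  haveI : CompactSpace b₁.carrier := b₁.compactSpace_carrier
  haveI : ConnectedSpace b₁.carrier :=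
    (helper_connected_seam M hM W₁ W₂ J₁ J₂ e₁ e₂ he₁
      he₂ hcover hseam₁ hseam₂ b₁).2.2
  -- F-a: a positively framed planar monodromy chart for the supporting open book
  obtain ⟨α, hGiroux⟩ := hsupp
  obtain ⟨K', n, φ, -, -, hGiroux', hframed, hmono⟩ :=
    hFa b₁.carrier ob (boundaryPlaneField J₁.J b₁) α hpl hGiroux
  -- Wendl, both halves, closed up
  obtain ⟨A, B, hin, hmonA, hmonB, hbody₁, hbody₂, hword⟩ :=
    hW M W₁ W₂ J₁ J₂ e₁ e₂ he₁ he₂ hcover hseam₁ hseam₂ hξ b₁ K' α n φ hGiroux' hframed hmono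
  refine ⟨n, A, B, hin, ?_, ?_, hmonA.trans hmonB.symm, ?_, ?_, hword⟩
  · -- lengths from ℚ-acyclicity
    simpa [positiveWord] using hRlen W₁ n (positiveWord A) hbody₁ (fun k hk => (hac k hk).1)
  · simpa [positiveWord] using hRlen W₂ n (positiveWord B) hbody₂ (fun k hk => (hac k hk).2)
  · -- `π₁(M) = 1` ⇒ the curves normally generate `F_n`
    have hsc : SimplyConnectedSpace M := simplyConnected_of_homotopyEquiv_sphere M hM
    have h := hRng M n (blockForm A B) hword hsc
    -- the curves of the block form are those of `A ++ B` (up to order)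
    unfold NormallyGenerates at h ⊢
    rw [← h]
    congr 1
    ext x
    simp [blockForm, positiveWord, List.mem_map, List.mem_reverse, List.mem_append]
  · -- `H₁(W₁; ℤ) = 0` ⇒ the hole matrix of `A` is unimodular
    intro hint
    have h := hRuni W₁ n (positiveWord A) hbody₁ hint
    rwa [map_fst_positiveWord] at h

/-- **WRITE-BACK (ii), the DOUBLE exit.**  If `M` is the planar word manifold of a homotopy-sphere
word `(n; A, B)` (integral, so that the orbit invariants apply) and the walk reaches a block form
`(n′; A′, B′)` with letterwise equal twists, then `M` is the double `D(X)` of a CONTRACTIBLE compact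
Stein domain `X = X(P_{n′}; A′)` whose boundary complex tangencies are supported by a planar open
book with `n′ + 1` binding components, along the same boundary datum.  Proof: moves (F-M) carry the
word manifold along the orbit; the curves of `A′ ++ B′` enclose nonempty in-page blocks
(`holes_of_reachable`); the double fact (F-D) gives `X`, `b` with `M = X ∪_{id} X`; Loi–Piergallini +
Gay (F-c) give the Stein structure and the supporting planar open book on `b`; `|A′| = n′`
(`length_of_reachable`) and `π₁(M) = 1` give contractibility of `X` (reader). [folklore] -/
theorem helper_dictionary_double (hMv : planarWordManifold_move_iff)
    (hD : planarWordManifold_isDouble_of_twistEq) (hLP : planarLefschetzBody_stein_supported)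
    (hRcd : planarLefschetzBody_contractible_of_isDouble)
    (M : Type) [TopologicalSpace M] [T2Space M] [SecondCountableTopology M] [ChartedSpace E4 M]
    [IsManifold (𝓡 4) ∞ M] (hM : M ≃ₕ 𝕊⁴) (n : ℕ) (A B : List PlanarCurve)
    (hw : IsIntegralSphereWord n A B) (hword : IsPlanarWordManifold M n (blockForm A B))
    (n' : ℕ) (A' B' : List PlanarCurve) (hr : Reachable (n, blockForm A B) (n', blockForm A' B'))
    (hte : TwistEq n' A' B') :
    ∃ (W : Type) (_ : TopologicalSpace W) (_ : T2Space W) (_ : SecondCountableTopology W)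
      (_ : ChartedSpace (EuclideanHalfSpace 4) W) (_ : IsManifold (𝓡∂ 4) ∞ W) (_ : CompactSpace W)
      (_ : ContractibleSpace W) (J : SteinStructure W) (b : BoundaryData (𝓡∂ 4) W (𝓡 3))
      (ob' : OpenBook b.carrier),
      ob'.IsPlanar ∧ ob'.k = n' + 1 ∧ ob'.Supports (boundaryPlaneField J.J b) ∧ IsDouble b (𝓡 4) M := by
  -- the word manifold at the reached state
  have hword' : IsPlanarWordManifold M n' (blockForm A' B') :=
    helper_wordManifold_of_reachable hMv M hr hword
  -- every reached curve encloses a nonempty in-page block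
  have hholes : ∀ c ∈ A' ++ B', c.a ≤ c.b ∧ c.b < n' := holes_of_reachable_blockForm hw hr
  -- the double
  obtain ⟨X, τ, η₂, σ₂, χ, μ, κ, b, hbody, hdouble⟩ := hD M n' A' B' hholes hte hword'
  -- Stein structure with supporting planar open book on `b`
  obtain ⟨S, ob', hpl', hk', hsupp'⟩ :=
    hLP X n' A' (fun c hc => hholes c (List.mem_append.2 (Or.inl hc))) hbody b
  -- contractibility
  have hlen : (positiveWord A').length = n' := by
    simpa [positiveWord] using (length_of_reachable hw hr).1
  have hcX : ContractibleSpace X :=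
    hRcd X n' (positiveWord A') b M hbody hlen hdouble (simplyConnected_of_homotopyEquiv_sphere M hM)
  exact ⟨X, τ, η₂, σ₂, χ, μ, κ, hcX, S, b, ob', hpl', hk', hsupp', hdouble⟩

/-- **WRITE-BACK (iv), the SIMPLY-CONNECTED-BLOCKS exit.**  If `M` is the planar word manifold of an
integral homotopy-sphere word `(n; A, B)` and the walk reaches a block form `(n′; A′, B′)` both of
whose blocks have curves normally generating `F_{n′}`, then `M` re-bisects along a common contact
seam into two CONTRACTIBLE compact Stein domains.  Proof: moves (F-M); `holes_of_reachable`; equal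
monodromies at the reached state (`helper_reachable_monodromy_eq`, landed); Baykur (F-S) writes the
Stein bisection `X(P; A′) ∪ X̄(P; B′)`; `|A′| = |B′| = n′` (`length_of_reachable`) and the
contractibility reader. [folklore] -/
theorem helper_dictionary_sc (hMv : planarWordManifold_move_iff) (hBay : baykur_planarSteinBisection)
    (hRc : planarLefschetzBody_contractible)
    (M : Type) [TopologicalSpace M] [T2Space M] [SecondCountableTopology M] [ChartedSpace E4 M]
    [IsManifold (𝓡 4) ∞ M] (n : ℕ) (A B : List PlanarCurve)
    (hw : IsIntegralSphereWord n A B) (hword : IsPlanarWordManifold M n (blockForm A B))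
    (n' : ℕ) (A' B' : List PlanarCurve) (hr : Reachable (n, blockForm A B) (n', blockForm A' B'))
    (hsc : NormallyGenerates n' A' ∧ NormallyGenerates n' B') :
    ∃ (V₁ : Type) (_ : TopologicalSpace V₁) (_ : ChartedSpace (EuclideanHalfSpace 4) V₁)
      (_ : IsManifold (𝓡∂ 4) ∞ V₁) (_ : CompactSpace V₁) (_ : ContractibleSpace V₁)
      (V₂ : Type) (_ : TopologicalSpace V₂) (_ : ChartedSpace (EuclideanHalfSpace 4) V₂)
      (_ : IsManifold (𝓡∂ 4) ∞ V₂) (_ : CompactSpace V₂) (_ : ContractibleSpace V₂)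
      (K₁ : SteinStructure V₁) (K₂ : SteinStructure V₂) (f₁ : V₁ → M) (f₂ : V₂ → M),
      Manifold.IsSmoothEmbedding (𝓡∂ 4) (𝓡 4) ∞ f₁ ∧ Manifold.IsSmoothEmbedding (𝓡∂ 4) (𝓡 4) ∞ f₂ ∧
      range f₁ ∪ range f₂ = univ ∧ range f₁ ∩ range f₂ = f₁ '' (𝓡∂ 4).boundary V₁ ∧
      range f₁ ∩ range f₂ = f₂ '' (𝓡∂ 4).boundary V₂ ∧
      (∀ v₁ v₂, f₁ v₁ = f₂ v₂ →
        Submodule.map (mfderiv (𝓡∂ 4) (𝓡 4) f₁ v₁).toLinearMap (contactPlane K₁.J v₁) =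
        Submodule.map (mfderiv (𝓡∂ 4) (𝓡 4) f₂ v₂).toLinearMap (contactPlane K₂.J v₂)) := by
  have hword' : IsPlanarWordManifold M n' (blockForm A' B') :=
    helper_wordManifold_of_reachable hMv M hr hword
  have hholes : ∀ c ∈ A' ++ B', c.a ≤ c.b ∧ c.b < n' := holes_of_reachable_blockForm hw hr
  have hmon' : monodromy n' (positiveWord A') = monodromy n' (positiveWord B') :=
    helper_reachable_monodromy_eq n n' A B A' B' hw hr
  obtain ⟨V₁, τ₁, χ₁, μ₁, κ₁, V₂, τ₂, χ₂, μ₂, κ₂, K₁, K₂, f₁, f₂, hf₁, hf₂, hcov, hs₁, hs₂, hξ', hb₁,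
    hb₂⟩ := hBay M n' A' B' hholes hmon' hword'
  haveI : T2Space V₁ := hf₁.isEmbedding.t2Space
  haveI : T2Space V₂ := hf₂.isEmbedding.t2Space
  haveI : SecondCountableTopology V₁ := hf₁.isEmbedding.secondCountableTopology
  haveI : SecondCountableTopology V₂ := hf₂.isEmbedding.secondCountableTopology
  have hlen := length_of_reachable hw hr
  have hngA : NormallyGenerates n' ((positiveWord A').map Prod.fst) := by
    rw [map_fst_positiveWord]; exact hsc.1
  have hngB : NormallyGenerates n' ((positiveWord B').map Prod.fst) := by
    rw [map_fst_positiveWord]; exact hsc.2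
  have hlenA : (positiveWord A').length = n' := by simpa [positiveWord] using hlen.1
  have hlenB : (positiveWord B').length = n' := by simpa [positiveWord] using hlen.2
  have hc₁ : ContractibleSpace V₁ := hRc V₁ n' (positiveWord A') hb₁ hngA hlenA
  have hc₂ : ContractibleSpace V₂ := hRc V₂ n' (positiveWord B') hb₂ hngB hlenB
  exact ⟨V₁, τ₁, χ₁, μ₁, κ₁, hc₁, V₂, τ₂, χ₂, μ₂, κ₂, hc₂, K₁, K₂, f₁, f₂, hf₁, hf₂, hcov, hs₁, hs₂, hξ'⟩

end Summit.SmoothPoincare4.SmoothPoincare4.Theorems.PlanarAcyclicBisectionRigidity.Sketch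

end
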